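import Mathlib
import HarnessLib
import Literature.Probability.MarkovChains.MetropolisHastings
import Summits.Ventures.LatticeQCDFlow.Exactness.NoisyAcceptBias

/-!
# LatticeQCDFlow / Exactness — `exp` of an unbiased estimate of the LOG-ratio ("noisy log-det")
is biased: when, in which exactness mode, and the smallest witnesses

HONEST FRAMING: exact (Metropolis-corrected) sampling algorithms for lattice gauge theory;
figures of merit are autocorrelation/cost numbers at stated couplings and volumes; no
continuum-physics claim.

Venture `LatticeQCDFlow` (cell pub-lqcd), topic `Exactness`; landed by FANOUT row 38 (r2-scope,
gen 2) as the Lean face of the planted control INVALID-4b / X-5b of HOME/R2-SCOPE.md §5 (companion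
of `NoisyAcceptBias.lean`, which treats X-5a = fresh unbiased estimates of the RATIO and its exact
pseudo-marginal twin V-4a).  NEW WORK of the cell (elementary finite arithmetic), not a published
result; printed counterparts are quoted in docstrings only.

Setting.  The accept/reweight functional needs the ratio `r = π y / π x` (for dynamical fermions:
the determinant ratio `det M(U') / det M(U)`), but what is cheap is an unbiased estimate `x̂` of
`log r` (a stochastic trace-log with a fixed number of noise vectors).  Using `exp x̂` in place of
`r` multiplies the exact ratio by a positive noise FACTOR `κ ξ = exp (x̂ - log r)` whose LOGARITHM
has mean zero.  By strict convexity of `exp` the mean factor `m = Σ_ξ g ξ · κ ξ` exceeds `1` unless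
the noise is degenerate (`jensen_exp`, `one_lt_mean_of_logUnbiased`) — "Simple exponentiation of
this estimator, i.e. e^⟨ΔH⟩, inevitably yields a bias" (Lin–Liu–Sloan 2000, hep-lat/9905033 §I).
What this does to the cell's two exactness modes (HOME/FITNESS.md 'Exactness modes'):

* REWEIGHT mode (self-normalised importance sampling `Σ ŵ O / Σ ŵ`, `ŵ = (π/q) · κ`): by the
  strong law the estimator converges to the expectation of `O` under `π · m` renormalised, where
  `m x` is the mean noise factor AT state `x` (`noisyReweightLaw`; the convergence itself is the
  classical strong law and is not formalised here).  If the noise law does not depend on the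
  state, `m` is constant and CANCELS: the limit is exact (`noisyReweightLaw_of_const`) —
  homogeneous noise costs variance (ESS), not bias.  Bias enters exactly through the state
  dependence of `m` (for trace-log estimators: of the noise variance).  Witness
  `noisyReweightLaw₂`: `(5/13, 8/13)` instead of `π₂ = (1/3, 2/3)` when state `0` carries the
  log-symmetric noise factor `κ₂ ∈ {2, 1/2}` (mean `5/4`) and state `1` none;
  `noisyReweightLaw₂_homogeneous`: the same factor at both states gives back `π₂`.
* CHAIN mode (a FRESH noise factor on the Hastings ratio at every step, `expNoiseRate`): biased
  even for state-INDEPENDENT symmetric log-noise, because `min (1, ·)` sits inside the noise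
  average.  Witness `expNoise₂_stationary_biased`: the same data give the stationary law
  `(5/13, 8/13)` (`expNoise₂_not_stationary`: `π₂` is not stationary).  Remark (not formalised):
  with EXACTLY Gaussian log-noise of KNOWN variance `σ²` the shifted test `min (1, exp (x̂ - σ²/2))`
  restores detailed balance (the penalty method, Ceperley–Dewing, J. Chem. Phys. 110 (1999) 9812;
  its exactness, and the inexactness of the estimated-variance variant, are discussed in
  Nicholls–Fox–Watt, arXiv:1205.6857 §3, where the uncorrected scheme is the "naive algorithm"
  that "does not in general target π"); a finite-noise-vector trace-log estimate is not Gaussian.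

Use: the scorer must reject X-5b in chain mode unconditionally, and in reweight mode the planted
control must carry STATE-DEPENDENT noise (few noise vectors, or a planted state-dependent noise
count), otherwise it is — correctly — scored VALID with a poor ESS (R2-SCOPE.md v1.0.4 §5).
The witness data `π₂`, `T₂`, `g₂` are those of `NoisyAcceptBias.lean`.
-/

namespace Summit.Ventures.LatticeQCDFlow.Exactness

open Finset
open Literature.Probability.MarkovChains


/-! ### Strict Jensen for `exp` on a finite noise law -/

section Jensen

variable {Ξ : Type*} [Fintype Ξ]

/-- Strict Jensen for `exp` on a finite law: if `g > 0` sums to one and the values `d` are not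
all equal then `exp (Σ g ξ · d ξ) < Σ g ξ · exp (d ξ)`.  In particular an estimator `x̂ = d ξ`
that is unbiased for `log r` satisfies `E[exp x̂] > r`. [folklore] -/
theorem jensen_exp {g d : Ξ → ℝ} (hg : ∀ ξ, 0 < g ξ) (hg1 : ∑ ξ, g ξ = 1)
    (hd : ∃ ξ ξ', d ξ ≠ d ξ') :
    Real.exp (∑ ξ, g ξ * d ξ) < ∑ ξ, g ξ * Real.exp (d ξ) := by
  obtain ⟨ξ, ξ', hne⟩ := hd
  have h : Real.exp (∑ i ∈ univ, g i • d i) < ∑ i ∈ univ, g i • Real.exp (d i) :=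
    strictConvexOn_exp.map_sum_lt (fun i _ => hg i) hg1 (fun i _ => Set.mem_univ _)
      ⟨ξ, mem_univ _, ξ', mem_univ _, hne⟩
  simpa only [smul_eq_mul] using h

/-- Ratio form: a positive noise factor `κ` that is unbiased IN THE LOGARITHM
(`Σ g ξ · log (κ ξ) = 0`) and not constant has mean `> 1` — the multiplicative bias of
`exp (noisy log-estimate)`. [folklore] -/
theorem one_lt_mean_of_logUnbiased {g κ : Ξ → ℝ} (hg : ∀ ξ, 0 < g ξ) (hg1 : ∑ ξ, g ξ = 1)
    (hκ : ∀ ξ, 0 < κ ξ) (h0 : ∑ ξ, g ξ * Real.log (κ ξ) = 0) (hne : ∃ ξ ξ', κ ξ ≠ κ ξ') :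
    1 < ∑ ξ, g ξ * κ ξ := by
  obtain ⟨ξ, ξ', hne⟩ := hne
  have hd : ∃ ξ ξ', Real.log (κ ξ) ≠ Real.log (κ ξ') :=
    ⟨ξ, ξ', fun h => hne (Real.log_injOn_pos (Set.mem_Ioi.mpr (hκ ξ)) (Set.mem_Ioi.mpr (hκ ξ')) h)⟩
  have h : Real.exp (∑ ξ, g ξ * Real.log (κ ξ)) < ∑ ξ, g ξ * Real.exp (Real.log (κ ξ)) :=
    jensen_exp hg hg1 hd
  rw [h0, Real.exp_zero] at h
  calc (1 : ℝ) < ∑ ξ, g ξ * Real.exp (Real.log (κ ξ)) := h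
    _ = ∑ ξ, g ξ * κ ξ := sum_congr rfl fun ξ _ => by rw [Real.exp_log (hκ ξ)]

end Jensen

/-! ### Reweight mode: the law sampled by self-normalised reweighting with noisy weights -/

section Reweight

variable {X : Type*} [Fintype X]

/-- The law effectively sampled by SELF-NORMALISED reweighting with noisy weights
`ŵ = (π / q) · κ`, `κ > 0` a noise factor whose mean at state `x` is `m x`: by the strong law of
large numbers `Σ ŵ O / Σ ŵ → (Σ_x π x · m x · O x) / (Σ_x π x · m x)` (the sampling law `q`
cancels), i.e. expectations are taken under `π · m` renormalised.  We record this limit law; the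
almost-sure convergence is the classical strong law and is not formalised here. [folklore] -/
noncomputable def noisyReweightLaw (π m : X → ℝ) (x : X) : ℝ := π x * m x / ∑ y, π y * m y

/-- HOMOGENEOUS noise is harmless in reweight mode: if the mean noise factor does not depend on
the state (`m ≡ c ≠ 0`) the limit law is `π` renormalised — only the variance (ESS) suffers, not
the target. [folklore] -/
theorem noisyReweightLaw_of_const (π : X → ℝ) {c : ℝ} (hc : c ≠ 0) (x : X) :
    noisyReweightLaw π (fun _ => c) x = π x / ∑ y, π y := by
  unfold noisyReweightLaw
  rw [← sum_mul, mul_div_mul_right _ _ hc]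

/-- Log-symmetric two-point noise factor `κ₂ = (2, 1/2)` (equiprobable under `g₂`): the
exponential of a symmetric `± log 2` error on a log-estimate. [folklore] -/
noncomputable def κ₂ : Fin 2 → ℝ := ![2, 1 / 2]

/-- First noise factor. [folklore] -/
@[simp] theorem κ₂_zero : κ₂ 0 = 2 := rfl
/-- Second noise factor. [folklore] -/
@[simp] theorem κ₂_one : κ₂ 1 = 1 / 2 := rfl

/-- The noise factor is positive. [folklore] -/
theorem κ₂_pos (ξ : Fin 2) : 0 < κ₂ ξ := by fin_cases ξ <;> simp

/-- `κ₂` is UNBIASED IN THE LOGARITHM: `Σ g₂ ξ · log (κ₂ ξ) = (log 2 + log (1/2)) / 2 = 0` — the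
underlying log-estimate is unbiased. [folklore] -/
theorem κ₂_logUnbiased : ∑ ξ, g₂ ξ * Real.log (κ₂ ξ) = 0 := by
  rw [Fin.sum_univ_two, g₂_apply, g₂_apply, κ₂_zero, κ₂_one, one_div, Real.log_inv]
  ring

/-- … yet its mean is `5/4 > 1` (Jensen): `exp` of the unbiased log-estimate over-estimates the
ratio by `25 %` on average. [folklore] -/
theorem κ₂_mean : ∑ ξ, g₂ ξ * κ₂ ξ = 5 / 4 := by
  rw [Fin.sum_univ_two, g₂_apply, g₂_apply, κ₂_zero, κ₂_one]
  norm_num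

/-- The general Jensen statement instantiated: `1 < Σ g₂ ξ · κ₂ ξ`. [folklore] -/
theorem one_lt_κ₂_mean : 1 < ∑ ξ, g₂ ξ * κ₂ ξ :=
  one_lt_mean_of_logUnbiased (fun ξ => by rw [g₂_apply]; norm_num)
    (by rw [Fin.sum_univ_two, g₂_apply]; norm_num) κ₂_pos κ₂_logUnbiased
    ⟨0, 1, by rw [κ₂_zero, κ₂_one]; norm_num⟩

/-- STATE-DEPENDENT mean noise factor of the reweighting witness: state `0` is estimated through
the noise factor `κ₂` (mean `5/4`), state `1` exactly (factor `1`). [folklore] -/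
noncomputable def m₂ : Fin 2 → ℝ := ![5 / 4, 1]

/-- Mean factor at state `0`. [folklore] -/
@[simp] theorem m₂_zero : m₂ 0 = 5 / 4 := rfl
/-- Mean factor at state `1`. [folklore] -/
@[simp] theorem m₂_one : m₂ 1 = 1 := rfl

/-- `m₂ 0` is the mean of the noise factor `κ₂` under `g₂`. [folklore] -/
theorem m₂_zero_eq_mean : m₂ 0 = ∑ ξ, g₂ ξ * κ₂ ξ := by rw [κ₂_mean, m₂_zero]

/-- **X-5b in reweight mode is biased through state-dependent noise**: the self-normalised limit
law of the witness is `(5/13, 8/13)`, not `π₂ = (1/3, 2/3)`. [folklore] -/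
theorem noisyReweightLaw₂ :
    noisyReweightLaw π₂ m₂ 0 = 5 / 13 ∧ noisyReweightLaw π₂ m₂ 1 = 8 / 13 := by
  constructor
  · simp only [noisyReweightLaw, Fin.sum_univ_two, π₂_zero, π₂_one, m₂_zero, m₂_one]
    norm_num
  · simp only [noisyReweightLaw, Fin.sum_univ_two, π₂_zero, π₂_one, m₂_zero, m₂_one]
    norm_num

/-- The reweight-mode limit misses the target at state `0`. [folklore] -/
theorem noisyReweightLaw₂_ne : noisyReweightLaw π₂ m₂ 0 ≠ π₂ 0 := by
  rw [noisyReweightLaw₂.1, π₂_zero]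
  norm_num

/-- … whereas the SAME noise applied at both states (homogeneous, mean factor `5/4` everywhere)
gives back `π₂` exactly (`π₂` is normalised). [folklore] -/
theorem noisyReweightLaw₂_homogeneous (x : Fin 2) :
    noisyReweightLaw π₂ (fun _ => (5 : ℝ) / 4) x = π₂ x := by
  rw [noisyReweightLaw_of_const π₂ (by norm_num : (5 : ℝ) / 4 ≠ 0), Fin.sum_univ_two, π₂_zero,
    π₂_one]
  norm_num

/-- Size of the reweight-mode defect of the witness: relative bias `2/13 ≈ 15 %` on state `0`.
[folklore] -/
theorem x5b₂_relative_bias : ((5 : ℝ) / 13 - 1 / 3) / (1 / 3) = 2 / 13 := by norm_num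

end Reweight

/-! ### Chain mode: a fresh noise factor on the Hastings ratio at every step -/

section Chain

variable {X Ξ : Type*} [Fintype X] [Fintype Ξ] [DecidableEq X]

/-- `univ.erase 0 = {1}` in `Fin 2` (private helper). [folklore] -/
private theorem erase_zero₂' : (univ : Finset (Fin 2)).erase 0 = {1} := by decide
/-- `univ.erase 1 = {0}` in `Fin 2` (private helper). [folklore] -/
private theorem erase_one₂' : (univ : Finset (Fin 2)).erase 1 = {0} := by decide

/-- Off-diagonal rate of the chain that multiplies the exact Hastings ratio by a FRESH noise factor
`κ ξ`, `ξ ∼ g`, at every step (`κ` = `exp` of the error of an unbiased log-estimate, e.g. of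
`-Δ tr log M`): `Σ_ξ g ξ · min (T x y) (κ ξ · π y · T y x / π x)`. [folklore] -/
noncomputable def expNoiseRate (T : X → X → ℝ) (π : X → ℝ) (κ : Ξ → ℝ) (g : Ξ → ℝ) (x y : X) :
    ℝ :=
  ∑ ξ, g ξ * min (T x y) (κ ξ * π y * T y x / π x)

/-- Transition matrix of the fresh-exp-noise chain: off-diagonal `expNoiseRate`, rejected mass on
the diagonal. [folklore] -/
noncomputable def expNoiseKernel (T : X → X → ℝ) (π : X → ℝ) (κ : Ξ → ℝ) (g : Ξ → ℝ) (x y : X) :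
    ℝ :=
  if y = x then 1 - ∑ z ∈ univ.erase x, expNoiseRate T π κ g x z else expNoiseRate T π κ g x y

/-- Off-diagonal entries of the fresh-exp-noise kernel. [folklore] -/
theorem expNoiseKernel_of_ne (T : X → X → ℝ) (π : X → ℝ) (κ : Ξ → ℝ) (g : Ξ → ℝ) {x y : X}
    (h : y ≠ x) : expNoiseKernel T π κ g x y = expNoiseRate T π κ g x y := if_neg h

/-- Diagonal entries of the fresh-exp-noise kernel. [folklore] -/
theorem expNoiseKernel_self (T : X → X → ℝ) (π : X → ℝ) (κ : Ξ → ℝ) (g : Ξ → ℝ) (x : X) :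
    expNoiseKernel T π κ g x x = 1 - ∑ z ∈ univ.erase x, expNoiseRate T π κ g x z := if_pos rfl

/-- Rows of the fresh-exp-noise kernel sum to one. [folklore] -/
theorem expNoiseKernel_sum_eq_one (T : X → X → ℝ) (π : X → ℝ) (κ : Ξ → ℝ) (g : Ξ → ℝ) (x : X) :
    ∑ y, expNoiseKernel T π κ g x y = 1 := by
  rw [← add_sum_erase _ _ (mem_univ x), expNoiseKernel_self]
  have : ∑ y ∈ univ.erase x, expNoiseKernel T π κ g x y =
      ∑ y ∈ univ.erase x, expNoiseRate T π κ g x y :=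
    sum_congr rfl fun y hy => expNoiseKernel_of_ne T π κ g (ne_of_mem_erase hy)
  rw [this]
  ring

omit [Fintype X] [DecidableEq X] in
/-- Sanity: a noise-free factor (`κ ≡ 1`) with a normalised noise law gives back the
Metropolis–Hastings rate — the defect below is caused by the fresh noise alone. [folklore] -/
theorem expNoiseRate_eq_mhRate_of_one {T : X → X → ℝ} {π : X → ℝ} {κ : Ξ → ℝ} {g : Ξ → ℝ}
    (hκ : ∀ ξ, κ ξ = 1) (hg1 : ∑ ξ, g ξ = 1) (x y : X) :
    expNoiseRate T π κ g x y = mhRate T π x y := by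
  unfold expNoiseRate mhRate
  simp_rw [hκ, one_mul, ← sum_mul, hg1, one_mul]

/-- Fresh-exp-noise rate `0 → 1` of the witness (`π₂`, uniform `T₂`, factor `κ₂ ∼ g₂`):
`(1/2)·[min(1/2, 2) + min(1/2, 1/2)] = 1/2` (exact MH value: `1/2`). [folklore] -/
theorem expNoiseRate₂_zero_one : expNoiseRate T₂ π₂ κ₂ g₂ 0 1 = 1 / 2 := by
  simp only [expNoiseRate, Fin.sum_univ_two, T₂_apply, g₂_apply, π₂_zero, π₂_one, κ₂_zero,
    κ₂_one]
  norm_num [min_def]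

/-- Fresh-exp-noise rate `1 → 0` of the witness: `(1/2)·[min(1/2, 1/2) + min(1/2, 1/8)] = 5/16`
(exact MH value: `1/4`). [folklore] -/
theorem expNoiseRate₂_one_zero : expNoiseRate T₂ π₂ κ₂ g₂ 1 0 = 5 / 16 := by
  simp only [expNoiseRate, Fin.sum_univ_two, T₂_apply, g₂_apply, π₂_zero, π₂_one, κ₂_zero,
    κ₂_one]
  norm_num [min_def]

/-- The four entries of the fresh-exp-noise kernel of the witness. [folklore] -/
theorem expNoiseKernel₂_entries :
    expNoiseKernel T₂ π₂ κ₂ g₂ 0 1 = 1 / 2 ∧ expNoiseKernel T₂ π₂ κ₂ g₂ 1 0 = 5 / 16 ∧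
      expNoiseKernel T₂ π₂ κ₂ g₂ 0 0 = 1 / 2 ∧ expNoiseKernel T₂ π₂ κ₂ g₂ 1 1 = 11 / 16 := by
  refine ⟨?_, ?_, ?_, ?_⟩
  · rw [expNoiseKernel_of_ne _ _ _ _ (by decide), expNoiseRate₂_zero_one]
  · rw [expNoiseKernel_of_ne _ _ _ _ (by decide), expNoiseRate₂_one_zero]
  · rw [expNoiseKernel_self, erase_zero₂', sum_singleton, expNoiseRate₂_zero_one]; norm_num
  · rw [expNoiseKernel_self, erase_one₂', sum_singleton, expNoiseRate₂_one_zero]; norm_num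

/-- **X-5b in chain mode is NOT exact, even with state-independent symmetric log-noise**:
`π₂ = (1/3, 2/3)` is not stationary (flow into state `1`: `(1/3)(1/2) + (2/3)(11/16) = 5/8 ≠ 2/3`).
Printed status: "Simple exponentiation of this estimator … inevitably yields a bias"
(Lin–Liu–Sloan 2000 §I); the "naive algorithm … does not in general target π"
(Nicholls–Fox–Watt 2012 §3).  Venture result (planted control INVALID-4b / X-5b). [folklore] -/
theorem expNoise₂_not_stationary : ¬ IsStationary π₂ (expNoiseKernel T₂ π₂ κ₂ g₂) := by
  intro h
  have h1 := h 1
  obtain ⟨h01, -, -, h11⟩ := expNoiseKernel₂_entries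
  rw [Fin.sum_univ_two, h01, h11, π₂_zero, π₂_one] at h1
  norm_num at h1

/-- The law the fresh-exp-noise chain DOES sample: `(5/13, 8/13)` is stationary
(`(5/13)(1/2) = (8/13)(5/16)`). [folklore] -/
theorem expNoise₂_stationary_biased :
    IsStationary ![(5 : ℝ) / 13, 8 / 13] (expNoiseKernel T₂ π₂ κ₂ g₂) := by
  obtain ⟨h01, h10, h00, h11⟩ := expNoiseKernel₂_entries
  intro y
  fin_cases y
  · simp only [Fin.sum_univ_two, Fin.zero_eta, Matrix.cons_val_zero, Matrix.cons_val_one, h00, h10]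
    norm_num
  · simp only [Fin.sum_univ_two, Fin.mk_one, Matrix.cons_val_zero, Matrix.cons_val_one, h01, h11]
    norm_num

/-- In this witness the chain-mode stationary law and the reweight-mode limit law COINCIDE
(`(5/13, 8/13)` both ways; a feature of two states with noise attached to one of them, not a
general identity). [folklore] -/
theorem expNoise₂_law_eq_noisyReweightLaw₂ :
    (![(5 : ℝ) / 13, 8 / 13] : Fin 2 → ℝ) = noisyReweightLaw π₂ m₂ := by
  obtain ⟨h0, h1⟩ := noisyReweightLaw₂
  funext x
  fin_cases x
  · simp only [Fin.zero_eta, Matrix.cons_val_zero, h0]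
  · simp only [Fin.mk_one, Matrix.cons_val_one, Matrix.cons_val_zero, h1]

end Chain

end Summit.Ventures.LatticeQCDFlow.Exactness
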